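import Mathlib
import Summits.BirchSwinnertonDyer.BirchSwinnertonDyer.Theorems.SignedLowerHalvesKobayashiLowerHalfSemistableTwoVarPrimes
import HarnessLib

/-!
# Crux `KobayashiLowerHalfSemistable` (route `SignedLowerHalves`, item 2 = stmt-BirchSwinnertonDyer-19000):
# the LOCAL-RING UNIT LIFT — «equality on ONE coordinate line of `Λ_K = ℤ_p⟦T₁⟧⟦T₂⟧` + two-variable
# divisibility ⇒ two-variable equality ⇒ equality on EVERY line» (the Transfer step of crux idea
# `Cruxes/KobayashiLowerHalfSemistable/Ideas/definite-line-unit-lift.md`, in the tree's currency)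

HONEST FRAMING (cell `bsd-ssimc`, README §4): commutative algebra only, Mathlib + tree; nothing here is
a theorem about any curve, any Selmer group or any `p`-adic `L`-function; the crux stays OPEN on the
ledger (closed BY NAME modulo `Supersingular.BurungaleSkinnerTianWan2024_thm13_scopedS_OPEN` at `p ≥ 5`
and `BSTW2024_lowerDivisibility_atThreeS_CELL` at `p = 3`, closer of record
`…Theorems.KobayashiLowerHalfSemistable_of_tiersS_C3`, p563654); the registered line `Lines/birth.lean`
(skeleton 7996fe65) is untouched; BSD is not proved by any of this. Seat `bsd-line-slh-p2` gen 2 (D-0154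
KEY (146) row 6), `--supports stmt-BirchSwinnertonDyer-19000`.

## What is proved, and what it is for

The idea card `definite-line-unit-lift` (ideator `bsd-idea-13`, lens *strengthen*, 2026-08-28) proposes
to replace the located open input G2 of the `p ≥ 5` branch (`stub_five_le`) of the crux — the
Klingen–Eisenstein divisibility at the trivial character — by an EQUALITY of signed main conjectures on
the DEFINITE anticyclotomic line over an auxiliary imaginary quadratic `K`, transported to the
cyclotomic line through the two-variable algebra `Λ_K`. Its «First lemma» / Transfer is pure ring
theory and is what this file lands, for an arbitrary units-reflecting ring map and then for the two
coordinate lines of the tree's model of `Λ_K`,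
`IwasawaAlgebra₂ p = PowerSeries (IwasawaAlgebra p) = ℤ_p⟦T_inner⟧⟦T_outer⟧`
(`Rubin1991/TwoVariableMainConjecture.lean`; `TwoVariableSelmerDual.lean`; the cell's
`…Theorems.TwoVarPrimes`, p567351):

* §1 (any commutative rings, `φ : A →+* B` reflecting units = `IsLocalHom φ`): if `f ∣ g` in `A`,
  `φ f` is a non-zero-divisor and `φ f`, `φ g` are associated in `B`, then `f`, `g` are associated in `A`
  (`associated_of_dvd_of_associated_map`: the cofactor maps to a unit, hence IS a unit —
  `isUnit_cofactor_of_map`); consequently `ψ f`, `ψ g` are associated, and generate the same principal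
  ideal, under EVERY ring map `ψ` out of `A` (`associated_map_of_dvd_of_associated_map`,
  `span_map_eq_of_dvd_of_associated_map`).
* §2 (`R⟦X⟧⟦Y⟧` over a domain `R`): both coordinate specialisations — `Y ↦ 0`
  (`PowerSeries.constantCoeff`, units-reflecting by the cell's `TwoVarPrimes.isLocalHom_constantCoeff`)
  and `X ↦ 0` (`PowerSeries.map PowerSeries.constantCoeff`, units-reflecting by Mathlib's
  `PowerSeries.map.isLocalHom`) — are admissible `φ`, and each transports association to the OTHER line:
  `associated_of_dvd_of_associated_constantCoeff`, `associated_of_dvd_of_associated_mapConstantCoeff`,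
  `associated_mapConstantCoeff_of_dvd_of_associated_constantCoeff`,
  `associated_constantCoeff_of_dvd_of_associated_mapConstantCoeff`.
* §3 (`Λ_K = IwasawaAlgebra₂ p`, divisibility currency of the crux): with `ξ` («`char_{Λ_K} X^ε`») and
  `L` («two-variable signed `p`-adic `L`-function»), the two-variable KATO direction `ξ ∣ L`, torsion of
  the definite-line restriction (`ξ|_line ≠ 0`) and the definite-line EQUALITY (`ξ|_line ~ L|_line`) give
  the EISENSTEIN direction `L|_other ∣ ξ|_other` on the other line — for either choice of which variable
  is the definite one (`dvd_constantCoeff_of_…`, `dvd_mapConstantCoeff_of_…`), and the equality of the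
  principal ideals there. The arithmetic identifications (control: `ξ|_cyc` generates the characteristic
  ideal of a `Kobayashi2003.SignedSelmerDualData`; interpolation: `L|_cyc` is `ϖ·L^ε` up to `Λˣ`) are
  NOT typed here; once supplied, the output plugs into the one-model sockets
  `…Theorems.ModelForm.kobayashiMainConjecture_of_model` / `kobayashiLowerDivisibility_of_dvd_model`
  (p607625 / p608704).
* §4 (cutting back from `E/K` to `E/ℚ`): on the cyclotomic line the two-variable objects for `E/K`
  restrict to PRODUCTS over `E` and its twist `E^K`; the ONE-SIDED sandwich `dvd_of_mul_dvd_mul_of_dvd`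
  (`x·y ∣ a·b`, `b ∣ y`, `b ≠ 0` ⇒ `x ∣ a`) shows the Eisenstein direction for `E` needs, beyond the
  product statement, ONLY the Kato direction for the twist `E^K` (the two-sided version is the tree's
  `IwasawaDivisibilityTransfer.associated_of_dvd_of_dvd_of_mul_dvd_mul`, BSTW II §10.3); composed with §3:
  `dvd_of_definiteLine_transfer` / `…'` — the card's Transfer end to end as ring theory, all arithmetic
  identifications entering as explicit equations, none asserted.

WHY A LOCAL RING: `Λ_K` is local, so a cofactor that becomes a unit on one line is a unit; this is the
rigidity the card's lens exploits («S⁺ is MORE RIGID because Λ_K is a LOCAL ring»). The hypothesis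
`ξ|_line ≠ 0` is essential (take `ξ = Y`, `g = Y·X` in `R⟦X⟧⟦Y⟧`: divisible, both restrictions to
`Y = 0` vanish and are associated, yet `Y` and `XY` are not associated) — it is the card's «definite
sign ⇒ torsion» input.

WHAT THIS IS NOT: not a line (no skeleton is registered for the card: the arithmetic carriers — the
two-variable SIGNED Selmer dual over `K_∞/K`, definite signed `θ`-elements, Howard's criterion — have no
tree declarations, card §«First lemma»); not a discharge of any `_OPEN` binder; no statement, binder,
route or skeleton edit; 0 kit; 0 new facts. PARTITION (D-0054): bsd-ssimc × X6 (A6 / D2) × p ≥ 5 —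
none (types the transfer step of an idea card); closes no cell.

References: [Kobayashi2003] Conjecture (Main Conjecture) (p. 2) (shape of the target only);
[Washington1997] §13.2 (characteristic ideals up to `Λˣ`); [Matsumura1987] Thm. 20.3 (regular local ⇒
UFD; only the locality of `Λ_K` is used here); idea card `definite-line-unit-lift` (commit 44ada49464ca).
-/

set_option autoImplicit false
set_option linter.dupNamespace false

noncomputable section

namespace Summit.BirchSwinnertonDyer.BirchSwinnertonDyer.Theorems.DefiniteLineUnitLift

/-! ### §1 The unit lift along a units-reflecting ring map -/

section General

variable {A B C : Type*} [CommRing A] [CommRing B] [CommRing C]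

/-- **Unit lift.** If `φ : A → B` reflects units, `φ f` is a non-zero-divisor of `B`, and
`φ (f * q) = φ f * u` for a unit `u` of `B`, then the cofactor `q` is a unit of `A`: cancelling `φ f`
gives `φ q = u`. (Card `definite-line-unit-lift`, First lemma `isUnit_cofactor_of_specialisation`.)
[cite: Washington1997, §13.2 (characteristic power series are defined up to units; shape only)] -/
theorem isUnit_cofactor_of_map (φ : A →+* B) [IsLocalHom φ] {f q : A} {u : B} (hu : IsUnit u)
    (hreg : φ f ∈ nonZeroDivisors B) (h : φ (f * q) = φ f * u) : IsUnit q := by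
  rw [map_mul, mul_cancel_left_mem_nonZeroDivisors hreg] at h
  exact IsUnit.of_map φ q (h ▸ hu)

/-- **Association lifts from one specialisation.** If `f ∣ g` in `A`, `φ` reflects units, `φ f` is a
non-zero-divisor and `φ f ~ φ g` in `B`, then `f ~ g` in `A`. [cite: Washington1997, §13.2 (shape only)] -/
theorem associated_of_dvd_of_associated_map (φ : A →+* B) [IsLocalHom φ] {f g : A} (hfg : f ∣ g)
    (hreg : φ f ∈ nonZeroDivisors B) (hφ : Associated (φ f) (φ g)) : Associated f g := by
  obtain ⟨q, rfl⟩ := hfg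
  obtain ⟨u, hu⟩ := hφ
  obtain ⟨v, hv⟩ := isUnit_cofactor_of_map φ u.isUnit hreg hu.symm
  exact ⟨v, by rw [hv]⟩

/-- The same, read on ANY other specialisation `ψ : A → C`: `ψ f ~ ψ g`. [cite: Washington1997, §13.2 (shape only)] -/
theorem associated_map_of_dvd_of_associated_map (φ : A →+* B) [IsLocalHom φ] (ψ : A →+* C) {f g : A}
    (hfg : f ∣ g) (hreg : φ f ∈ nonZeroDivisors B) (hφ : Associated (φ f) (φ g)) :
    Associated (ψ f) (ψ g) :=
  (associated_of_dvd_of_associated_map φ hfg hreg hφ).map ψ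

/-- Associated elements generate the same principal ideal (no domain hypothesis). [folklore] -/
theorem span_singleton_eq_of_associated {x y : A} (h : Associated x y) :
    Ideal.span ({x} : Set A) = Ideal.span {y} :=
  le_antisymm (Ideal.span_singleton_le_span_singleton.mpr h.symm.dvd)
    (Ideal.span_singleton_le_span_singleton.mpr h.dvd)

/-- Ideal form on the other specialisation: `(ψ f) = (ψ g)` as principal ideals of `C`. [cite: Washington1997, §13.2 (shape only)] -/
theorem span_map_eq_of_dvd_of_associated_map (φ : A →+* B) [IsLocalHom φ] (ψ : A →+* C) {f g : A}
    (hfg : f ∣ g) (hreg : φ f ∈ nonZeroDivisors B) (hφ : Associated (φ f) (φ g)) :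
    Ideal.span ({ψ f} : Set C) = Ideal.span {ψ g} :=
  span_singleton_eq_of_associated (associated_map_of_dvd_of_associated_map φ ψ hfg hreg hφ)

/-- Divisibility form on the other specialisation: the REVERSE divisibility `ψ g ∣ ψ f` (the given one,
`ψ f ∣ ψ g`, is automatic from `f ∣ g`). [cite: Washington1997, §13.2 (shape only)] -/
theorem map_dvd_map_of_dvd_of_associated_map (φ : A →+* B) [IsLocalHom φ] (ψ : A →+* C) {f g : A}
    (hfg : f ∣ g) (hreg : φ f ∈ nonZeroDivisors B) (hφ : Associated (φ f) (φ g)) : ψ g ∣ ψ f :=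
  (associated_map_of_dvd_of_associated_map φ ψ hfg hreg hφ).symm.dvd

end General

/-! ### §2 The two coordinate lines of `R⟦X⟧⟦Y⟧` -/

section TwoLines

variable {R : Type*} [CommRing R]

/-- Restriction to the line `X = 0` (inner variable), `R⟦X⟧⟦Y⟧ → R⟦Y⟧`, reflects units (Mathlib
`PowerSeries.map.isLocalHom` applied to the units-reflecting `constantCoeff : R⟦X⟧ → R`,
`TwoVarPrimes.isLocalHom_constantCoeff`). [folklore] -/
theorem isLocalHom_mapConstantCoeff :
    IsLocalHom (PowerSeries.map (PowerSeries.constantCoeff (R := R))) :=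
  haveI := TwoVarPrimes.isLocalHom_constantCoeff (R := R)
  PowerSeries.map.isLocalHom _

variable [IsDomain R]

/-- **Line `Y = 0` ⇒ two variables.** In `R⟦X⟧⟦Y⟧` over a domain: `F ∣ G`, `F(X,0) ≠ 0` and
`F(X,0) ~ G(X,0)` in `R⟦X⟧` imply `F ~ G`. [cite: Washington1997, §13.2 (shape only)] -/
theorem associated_of_dvd_of_associated_constantCoeff {F G : PowerSeries (PowerSeries R)} (hFG : F ∣ G)
    (hF : PowerSeries.constantCoeff F ≠ 0)
    (h : Associated (PowerSeries.constantCoeff F) (PowerSeries.constantCoeff G)) : Associated F G :=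
  haveI := TwoVarPrimes.isLocalHom_constantCoeff (R := PowerSeries R)
  associated_of_dvd_of_associated_map _ hFG (mem_nonZeroDivisors_of_ne_zero hF) h

/-- **Line `X = 0` ⇒ two variables.** In `R⟦X⟧⟦Y⟧` over a domain: `F ∣ G`, `F(0,Y) ≠ 0` and
`F(0,Y) ~ G(0,Y)` in `R⟦Y⟧` imply `F ~ G`. [cite: Washington1997, §13.2 (shape only)] -/
theorem associated_of_dvd_of_associated_mapConstantCoeff {F G : PowerSeries (PowerSeries R)}
    (hFG : F ∣ G) (hF : PowerSeries.map PowerSeries.constantCoeff F ≠ 0)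
    (h : Associated (PowerSeries.map PowerSeries.constantCoeff F)
      (PowerSeries.map PowerSeries.constantCoeff G)) : Associated F G :=
  haveI := isLocalHom_mapConstantCoeff (R := R)
  associated_of_dvd_of_associated_map _ hFG (mem_nonZeroDivisors_of_ne_zero hF) h

/-- **Line `Y = 0` ⇒ line `X = 0`.** [cite: Washington1997, §13.2 (shape only)] -/
theorem associated_mapConstantCoeff_of_dvd_of_associated_constantCoeff {F G : PowerSeries (PowerSeries R)}
    (hFG : F ∣ G) (hF : PowerSeries.constantCoeff F ≠ 0)
    (h : Associated (PowerSeries.constantCoeff F) (PowerSeries.constantCoeff G)) :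
    Associated (PowerSeries.map PowerSeries.constantCoeff F)
      (PowerSeries.map PowerSeries.constantCoeff G) :=
  (associated_of_dvd_of_associated_constantCoeff hFG hF h).map _

/-- **Line `X = 0` ⇒ line `Y = 0`.** [cite: Washington1997, §13.2 (shape only)] -/
theorem associated_constantCoeff_of_dvd_of_associated_mapConstantCoeff {F G : PowerSeries (PowerSeries R)}
    (hFG : F ∣ G) (hF : PowerSeries.map PowerSeries.constantCoeff F ≠ 0)
    (h : Associated (PowerSeries.map PowerSeries.constantCoeff F)
      (PowerSeries.map PowerSeries.constantCoeff G)) :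
    Associated (PowerSeries.constantCoeff F) (PowerSeries.constantCoeff G) :=
  (associated_of_dvd_of_associated_mapConstantCoeff hFG hF h).map _

/-- The non-vanishing hypothesis on the line is ESSENTIAL: `F = Y`, `G = Y·X` in `R⟦X⟧⟦Y⟧` (`R`
nontrivial) satisfy `F ∣ G` and `F(X,0) = 0 = G(X,0)` (associated), but `F`, `G` are NOT associated
(else `X` would be a unit of `R⟦X⟧`). [folklore] -/
theorem not_associated_X_X_mul_C_X :
    ¬ Associated (PowerSeries.X : PowerSeries (PowerSeries R))
        (PowerSeries.X * PowerSeries.C (PowerSeries.X : PowerSeries R)) := by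
  rintro ⟨u, hu⟩
  have hX : (PowerSeries.X : PowerSeries (PowerSeries R)) ≠ 0 := PowerSeries.X_ne_zero
  have hu' : ((u : PowerSeries (PowerSeries R))) = PowerSeries.C (PowerSeries.X : PowerSeries R) :=
    mul_left_cancel₀ hX hu
  have hunit : IsUnit (PowerSeries.C (PowerSeries.X : PowerSeries R)) := hu' ▸ u.isUnit
  have hXunit : IsUnit (PowerSeries.X : PowerSeries R) := by
    have := hunit.map (PowerSeries.constantCoeff (R := PowerSeries R))
    rwa [PowerSeries.constantCoeff_C] at this
  exact PowerSeries.X_prime.not_unit hXunit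

end TwoLines

/-! ### §3 `Λ_K = ℤ_p⟦T_inner⟧⟦T_outer⟧`: Kato direction + definite-line equality ⇒ Eisenstein direction on the other line -/

section IwasawaTwoVar

open Literature.NumberTheory.EllipticCurves

variable {p : ℕ} [Fact p.Prime]

/-- **Definite line = `T_outer = 0`, read on `T_inner = 0`.** In `Λ_K = ℤ_p⟦T_inner⟧⟦T_outer⟧`: from the
two-variable Kato direction `ξ ∣ L`, torsion on the definite line `ξ(T_inner, 0) ≠ 0` and the
definite-line equality `ξ(T_inner,0) ~ L(T_inner,0)`, the EISENSTEIN direction `L(0,T) ∣ ξ(0,T)` on the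
other line (and, trivially, `ξ(0,T) ∣ L(0,T)`). [cite: Kobayashi2003, Conjecture (Main Conjecture) (p. 2) (shape of the target only)] -/
theorem dvd_mapConstantCoeff_of_dvd_of_associated_constantCoeff
    {ξ L : PowerSeries (IwasawaAlgebra p)} (hKato : ξ ∣ L) (htors : PowerSeries.constantCoeff ξ ≠ 0)
    (hdef : Associated (PowerSeries.constantCoeff ξ) (PowerSeries.constantCoeff L)) :
    PowerSeries.map PowerSeries.constantCoeff L ∣ PowerSeries.map PowerSeries.constantCoeff ξ :=
  (associated_mapConstantCoeff_of_dvd_of_associated_constantCoeff hKato htors hdef).symm.dvd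

/-- **Definite line = `T_inner = 0`, read on `T_outer = 0`.** Same with the roles of the two variables
exchanged: `ξ ∣ L`, `ξ(0,T) ≠ 0`, `ξ(0,T) ~ L(0,T)` ⇒ `L(T,0) ∣ ξ(T,0)`.
[cite: Kobayashi2003, Conjecture (Main Conjecture) (p. 2) (shape of the target only)] -/
theorem dvd_constantCoeff_of_dvd_of_associated_mapConstantCoeff
    {ξ L : PowerSeries (IwasawaAlgebra p)} (hKato : ξ ∣ L)
    (htors : PowerSeries.map PowerSeries.constantCoeff ξ ≠ 0)
    (hdef : Associated (PowerSeries.map PowerSeries.constantCoeff ξ)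
      (PowerSeries.map PowerSeries.constantCoeff L)) :
    PowerSeries.constantCoeff L ∣ PowerSeries.constantCoeff ξ :=
  (associated_constantCoeff_of_dvd_of_associated_mapConstantCoeff hKato htors hdef).symm.dvd

/-- Two-variable EQUALITY of principal ideals `(ξ) = (L)` in `Λ_K` from the Kato direction and the
definite-line (`T_outer = 0`) data. [cite: Kobayashi2003, Conjecture (Main Conjecture) (p. 2) (shape of the target only)] -/
theorem span_eq_of_dvd_of_associated_constantCoeff {ξ L : PowerSeries (IwasawaAlgebra p)}
    (hKato : ξ ∣ L) (htors : PowerSeries.constantCoeff ξ ≠ 0)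
    (hdef : Associated (PowerSeries.constantCoeff ξ) (PowerSeries.constantCoeff L)) :
    Ideal.span ({ξ} : Set (PowerSeries (IwasawaAlgebra p))) = Ideal.span {L} :=
  span_singleton_eq_of_associated (associated_of_dvd_of_associated_constantCoeff hKato htors hdef)

/-- … and the induced EQUALITY `(L(0,T)) = (ξ(0,T))` of principal ideals of the one-variable
`Λ = ℤ_p⟦T⟧` on the other line — the shape `char = (generator)` the one-model sockets of
`…Theorems.ModelForm` consume. [cite: Kobayashi2003, Conjecture (Main Conjecture) (p. 2) (shape of the target only)] -/
theorem span_mapConstantCoeff_eq_of_dvd_of_associated_constantCoeff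
    {ξ L : PowerSeries (IwasawaAlgebra p)} (hKato : ξ ∣ L) (htors : PowerSeries.constantCoeff ξ ≠ 0)
    (hdef : Associated (PowerSeries.constantCoeff ξ) (PowerSeries.constantCoeff L)) :
    Ideal.span ({PowerSeries.map PowerSeries.constantCoeff ξ} : Set (IwasawaAlgebra p)) =
      Ideal.span {PowerSeries.map PowerSeries.constantCoeff L} :=
  haveI := TwoVarPrimes.isLocalHom_constantCoeff (R := IwasawaAlgebra p)
  span_map_eq_of_dvd_of_associated_map _ _ hKato (mem_nonZeroDivisors_of_ne_zero htors) hdef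

/-- Roles exchanged: `(L(T,0)) = (ξ(T,0))` from the `T_inner = 0` data.
[cite: Kobayashi2003, Conjecture (Main Conjecture) (p. 2) (shape of the target only)] -/
theorem span_constantCoeff_eq_of_dvd_of_associated_mapConstantCoeff
    {ξ L : PowerSeries (IwasawaAlgebra p)} (hKato : ξ ∣ L)
    (htors : PowerSeries.map PowerSeries.constantCoeff ξ ≠ 0)
    (hdef : Associated (PowerSeries.map PowerSeries.constantCoeff ξ)
      (PowerSeries.map PowerSeries.constantCoeff L)) :
    Ideal.span ({PowerSeries.constantCoeff ξ} : Set (IwasawaAlgebra p)) =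
      Ideal.span {PowerSeries.constantCoeff L} :=
  haveI := isLocalHom_mapConstantCoeff (R := ℤ_[p])
  span_map_eq_of_dvd_of_associated_map _ _ hKato (mem_nonZeroDivisors_of_ne_zero htors) hdef

end IwasawaTwoVar

/-! ### §4 Cutting back from `E/K` to `E/ℚ` on the cyclotomic line: the ONE-SIDED sandwich -/

section OneSidedSandwich

variable {α : Type*} [CommMonoidWithZero α] [IsCancelMulZero α]

/-- **One-sided divisibility sandwich.** If `x * y ∣ a * b`, `b ∣ y` and `b ≠ 0`, then `x ∣ a`. Read with
`a = char X^ε(E/ℚ_∞)`, `b = char X^ε(E^K/ℚ_∞)`, `x = L^ε_p(E)`, `y = L^ε_p(E^K)`: the EISENSTEIN direction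
for the base change `E/K` on the cyclotomic line (`x y ∣ a b`) and the KATO direction for the twist ALONE
(`b ∣ y`, Kobayashi Thm. 4.1 for `E^K`) already give the Eisenstein direction `x ∣ a` for `E` — the
lower half the crux asks for; the two-sided version (both Kato directions ⇒ both equalities) is the tree's
`IwasawaDivisibilityTransfer.associated_of_dvd_of_dvd_of_mul_dvd_mul`.
[cite: BurungaleSkinnerTianWan2024, Part II §2.3 (proof of the theorem labelled KoMC_r = Thm. 1.3; ring-theoretic step only; PREPRINT)] -/
theorem dvd_of_mul_dvd_mul_of_dvd {a b x y : α} (hb : b ≠ 0) (hprod : x * y ∣ a * b) (htw : b ∣ y) :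
    x ∣ a := by
  obtain ⟨c, rfl⟩ := htw
  have h : x * c * b ∣ a * b := by
    rw [mul_right_comm, mul_assoc]
    exact hprod
  exact dvd_trans (dvd_mul_right x c) ((mul_dvd_mul_iff_right hb).mp h)

end OneSidedSandwich

section Transfer

open Literature.NumberTheory.EllipticCurves

variable {p : ℕ} [Fact p.Prime]

/-- **The card's Transfer, end to end, as ring theory** (definite line = `T_outer = 0`, cyclotomic line
= `T_inner = 0` of `Λ_K = ℤ_p⟦T_inner⟧⟦T_outer⟧`). INPUT: two-variable Kato direction `ξ ∣ L`; torsion and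
EQUALITY on the definite line; on the cyclotomic line the factorizations `ξ(0,T) = a·b`, `L(0,T) = x·y`
(standing for control: `a`, `b` generate `char X^ε` of `E`, `E^K` over `ℚ_∞`; interpolation: `x`, `y`
the signed `p`-adic `L`-functions of `E`, `E^K` up to `Λˣ`) and the Kato direction `b ∣ y` for the twist,
`b ≠ 0`. OUTPUT: `x ∣ a` — the shape of `KobayashiLowerDivisibility` for `E` that the integral socket
`…Theorems.ModelForm.kobayashiLowerDivisibility_of_dvd_model` (p608704) consumes. None of the arithmetic
identifications is asserted here. [cite: BurungaleSkinnerTianWan2024, Part II §2.3 (proof of the theorem labelled KoMC_r = Thm. 1.3; ring-theoretic step only; PREPRINT)] -/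
theorem dvd_of_definiteLine_transfer {ξ L : PowerSeries (IwasawaAlgebra p)} {a b x y : IwasawaAlgebra p}
    (hKato₂ : ξ ∣ L) (htors : PowerSeries.constantCoeff ξ ≠ 0)
    (hdef : Associated (PowerSeries.constantCoeff ξ) (PowerSeries.constantCoeff L))
    (hξ : PowerSeries.map PowerSeries.constantCoeff ξ = a * b)
    (hL : PowerSeries.map PowerSeries.constantCoeff L = x * y) (hb : b ≠ 0) (hKato_twist : b ∣ y) :
    x ∣ a := by
  have h := dvd_mapConstantCoeff_of_dvd_of_associated_constantCoeff hKato₂ htors hdef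
  rw [hξ, hL] at h
  exact dvd_of_mul_dvd_mul_of_dvd hb h hKato_twist

/-- The same Transfer with the roles of the two variables exchanged (definite line = `T_inner = 0`,
cyclotomic line = `T_outer = 0`). [cite: BurungaleSkinnerTianWan2024, Part II §2.3 (proof of the theorem labelled KoMC_r = Thm. 1.3; ring-theoretic step only; PREPRINT)] -/
theorem dvd_of_definiteLine_transfer' {ξ L : PowerSeries (IwasawaAlgebra p)} {a b x y : IwasawaAlgebra p}
    (hKato₂ : ξ ∣ L) (htors : PowerSeries.map PowerSeries.constantCoeff ξ ≠ 0)
    (hdef : Associated (PowerSeries.map PowerSeries.constantCoeff ξ)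
      (PowerSeries.map PowerSeries.constantCoeff L))
    (hξ : PowerSeries.constantCoeff ξ = a * b) (hL : PowerSeries.constantCoeff L = x * y) (hb : b ≠ 0)
    (hKato_twist : b ∣ y) : x ∣ a := by
  have h := dvd_constantCoeff_of_dvd_of_associated_mapConstantCoeff hKato₂ htors hdef
  rw [hξ, hL] at h
  exact dvd_of_mul_dvd_mul_of_dvd hb h hKato_twist

end Transfer

end Summit.BirchSwinnertonDyer.BirchSwinnertonDyer.Theorems.DefiniteLineUnitLift

end
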